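import Mathlib

/-!
# Tangency flag systems for `stub_tangencySets` (crux `LevelOneGL2Designs`,
stmt-MatrixMultiplication-14080) — wall-breaker axis 9: random-algebraic constructions with
certified small instances

The packing stub `stub_tangencySets` of the line `Sketch` asks for: `∃ c > 0`, for unboundedly many
primes `p`, a finite set `S` of pairs `(u, v) ∈ 𝔽_p² × 𝔽_p²` with `c · p ^ (3/2) ≤ |S|` and
`u ⬝ᵥ v' = 1 ↔ (u, v) = (u', v')` for all `(u, v), (u', v') ∈ S`.  Reading `u` as a point of
`AG(2,p) ∖ {0}` and `v` as the line `{x : x ⬝ᵥ v = 1}` (a line avoiding the origin), `S` is a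
*strong representative system* / *tangency set*: points `P` each carrying a tangent line that meets
`P` only there (Illés–Szőnyi–Wettl 1991; Bruen–Thas bound `|S| ≤ p√p + 1`, equality iff unital,
so only for square orders).  For PRIME `p` the best construction in print has size `≫ p^{1.2334}`
(Hunter–Pohoata–Verstraëte–Zhang 2026, arXiv:2601.19879, Thm 1.2: Ruzsa square-difference-free sets
lifted along a parabola; before that `Θ(p log p)`, Szőnyi 1992), and their Conjecture 10.2 asserts
`IM(2,p) ≤ p^{3/2-c}` for all large primes — i.e. that this stub is FALSE; its negation would imply
power savings for Paley clique numbers and for the Furstenberg–Sárközy problem (ibid. §10).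

This file lands the elementary, kernel-checked objects the construction axis needs:

* `tangencyFlags_of_normals` — the REDUCTION every construction uses: a point set `P ⊆ 𝔽_p²` with,
  for each `z ∈ P`, a normal vector `n z` such that `z ⬝ᵥ n z ≠ 0` (the line
  `{x : x ⬝ᵥ n z = z ⬝ᵥ n z}` avoids the origin) and `z` is the only point of `P` on that line,
  yields a flag system `S` of the stub's type with `|S| = |P|`;
* `tangencyFlags_linePencil` — the all-primes linear family (points of the line `y = 1`, tangents
  through the point `(1,0)`): `|S| = p` for every prime `p`, hence the stub's shape holds at
  exponent `1` with `c = 1` (`tangencySets_exponent_one`);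
* certified small instances (`decide`, found by local search `comp/tangency_local.py`):
  `|S| = 4, 10, 17` at `p = 3, 5, 7`, i.e. `0.77, 0.89, 0.92 · p^{3/2}` (ISW ceilings `6, 12, 19`).

Nothing here closes the stub; see `AXIS.md` of the seat for what the axis reduces it to.
-/

set_option linter.dupNamespace false

namespace Summit.MatrixMultiplication.MatrixMultiplication.Theorems.LevelOneGL2Designs.FlagLine

namespace TangencyCertified

open Finset Matrix

section Reduction

variable {p : ℕ} [Fact p.Prime]

/-- **Reduction (points with private lines ⇒ flag system).**  Let `P ⊆ 𝔽_p²` be finite and let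
`n z` (`z ∈ P`) be normal vectors with `z ⬝ᵥ n z ≠ 0` such that `z` is the only point of `P` on
the line `{x : x ⬝ᵥ n z = z ⬝ᵥ n z}`.  Then the flags `(z, (z ⬝ᵥ n z)⁻¹ • n z)` form a set `S`
with `|S| = |P|` and `u ⬝ᵥ v' = 1 ↔ (u,v) = (u',v')` on `S × S` — exactly the shape asked by
`stub_tangencySets`. [elementary] -/
theorem tangencyFlags_of_normals (P : Finset (Fin 2 → ZMod p))
    (n : (Fin 2 → ZMod p) → (Fin 2 → ZMod p))
    (h0 : ∀ z ∈ P, z ⬝ᵥ n z ≠ 0)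
    (huniq : ∀ z ∈ P, ∀ z' ∈ P, z' ⬝ᵥ n z = z ⬝ᵥ n z → z' = z) :
    ∃ S : Finset ((Fin 2 → ZMod p) × (Fin 2 → ZMod p)), S.card = P.card ∧
      ∀ f ∈ S, ∀ f' ∈ S, (dotProduct f.1 f'.2 = 1 ↔ f = f') := by
  classical
  refine ⟨P.image (fun z => (z, (z ⬝ᵥ n z)⁻¹ • n z)), ?_, ?_⟩
  · exact Finset.card_image_of_injective _ (fun z z' h => congrArg Prod.fst h)
  · intro f hf f' hf'
    simp only [Finset.mem_image] at hf hf'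
    obtain ⟨z, hz, rfl⟩ := hf
    obtain ⟨z', hz', rfl⟩ := hf'
    constructor
    · intro h
      have h' : z ⬝ᵥ n z' = z' ⬝ᵥ n z' := by
        rw [dotProduct_smul, smul_eq_mul] at h
        have hne := h0 z' hz'
        field_simp at h
        linear_combination h
      have hzz : z = z' := huniq z' hz' z hz h'
      subst hzz
      rfl
    · intro h
      have hzz : z = z' := congrArg Prod.fst h
      subst hzz
      rw [dotProduct_smul, smul_eq_mul, inv_mul_cancel₀ (h0 z hz)]

/-- Directional form of the reduction: if every `z ∈ P` has a direction `d z` such that the line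
`z + 𝔽_p · d z` misses the origin (`z ⬝ᵥ (d z)^⊥ ≠ 0` with `(a,b)^⊥ = (-b,a)`) and contains no other
point of `P`, then `P` supports a flag system of the stub's shape of size `|P|`.  (A point `z'`
lies on that line iff `z' ⬝ᵥ (d z)^⊥ = z ⬝ᵥ (d z)^⊥`.) [elementary] -/
theorem tangencyFlags_of_directions (P : Finset (Fin 2 → ZMod p))
    (d : (Fin 2 → ZMod p) → (Fin 2 → ZMod p))
    (h0 : ∀ z ∈ P, z ⬝ᵥ ![-(d z 1), d z 0] ≠ 0)
    (huniq : ∀ z ∈ P, ∀ z' ∈ P, (∃ t : ZMod p, z' = z + t • d z) → z' = z) :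
    ∃ S : Finset ((Fin 2 → ZMod p) × (Fin 2 → ZMod p)), S.card = P.card ∧
      ∀ f ∈ S, ∀ f' ∈ S, (dotProduct f.1 f'.2 = 1 ↔ f = f') := by
  refine tangencyFlags_of_normals P (fun z => ![-(d z 1), d z 0]) h0 ?_
  intro z hz z' hz' h
  apply huniq z hz z' hz'
  -- `z' - z` is orthogonal to `(d z)^⊥`, hence parallel to `d z`.
  have hz0 := h0 z hz
  simp only [dotProduct, Fin.sum_univ_two, Matrix.cons_val_zero, Matrix.cons_val_one] at h hz0
  by_cases hd0 : d z 0 = 0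
  · have hd1 : d z 1 ≠ 0 := by
      intro hd1
      apply hz0
      simp [hd0, hd1]
    refine ⟨(z' 1 - z 1) / d z 1, ?_⟩
    ext i
    fin_cases i
    · simp only [Fin.zero_eta, Pi.add_apply, Pi.smul_apply, smul_eq_mul, hd0, mul_zero, add_zero]
      rw [hd0] at h
      have : (z' 0 - z 0) * d z 1 = 0 := by linear_combination -h
      rcases mul_eq_zero.mp this with h1 | h1
      · linear_combination h1
      · exact absurd h1 hd1
    · simp only [Fin.mk_one, Pi.add_apply, Pi.smul_apply, smul_eq_mul]
      field_simp
      ring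
  · refine ⟨(z' 0 - z 0) / d z 0, ?_⟩
    ext i
    fin_cases i
    · simp only [Fin.zero_eta, Pi.add_apply, Pi.smul_apply, smul_eq_mul]
      field_simp
      ring
    · simp only [Fin.mk_one, Pi.add_apply, Pi.smul_apply, smul_eq_mul]
      field_simp
      linear_combination h

end Reduction

section LinePencil

variable (p : ℕ) [Fact p.Prime]

/-- **The linear family (all primes).**  Points `(a, 1)` of the line `y = 1` with tangent lines
`x + (1 - a) y = 1` (the pencil through `(1, 0)`): `(a,1) ⬝ᵥ (1, 1-b) = 1 ↔ a = b`, so these `p`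
flags satisfy the design condition of `stub_tangencySets`.  Size `p` = exponent `1`. [elementary] -/
theorem tangencyFlags_linePencil :
    ∃ S : Finset ((Fin 2 → ZMod p) × (Fin 2 → ZMod p)), S.card = p ∧
      ∀ f ∈ S, ∀ f' ∈ S, (dotProduct f.1 f'.2 = 1 ↔ f = f') := by
  classical
  refine ⟨(Finset.univ : Finset (ZMod p)).image (fun a => (![a, 1], ![1, 1 - a])), ?_, ?_⟩
  · rw [Finset.card_image_of_injective, Finset.card_univ, ZMod.card]
    intro a b h
    have := congrArg (fun q : (Fin 2 → ZMod p) × (Fin 2 → ZMod p) => q.1 0) h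
    simpa using this
  · intro f hf f' hf'
    simp only [Finset.mem_image, Finset.mem_univ, true_and] at hf hf'
    obtain ⟨a, rfl⟩ := hf
    obtain ⟨b, rfl⟩ := hf'
    simp only [vec2_dotProduct, Matrix.cons_val_zero, Matrix.cons_val_one, Prod.mk.injEq]
    constructor
    · intro h
      have hab : a = b := by linear_combination h
      subst hab
      exact ⟨rfl, rfl⟩
    · rintro ⟨h, -⟩
      have hab : a = b := by
        have := congrFun h 0
        simpa using this
      subst hab
      ring

/-- The stub's `∃ c ∀ p₀ ∃ p` shape holds at EXPONENT ONE with `c = 1` (from the linear family and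
the infinitude of primes).  Calibration only: the stub asks for exponent `3/2`. [elementary] -/
theorem tangencySets_exponent_one :
    ∃ c : ℝ, 0 < c ∧ ∀ p₀ : ℕ, ∃ (p : ℕ) (_ : Fact p.Prime), p₀ ≤ p ∧
      ∃ S : Finset ((Fin 2 → ZMod p) × (Fin 2 → ZMod p)),
        c * (p : ℝ) ^ (1 : ℝ) ≤ S.card ∧ ∀ f ∈ S, ∀ f' ∈ S, (dotProduct f.1 f'.2 = 1 ↔ f = f') := by
  refine ⟨1, one_pos, fun p₀ => ?_⟩
  obtain ⟨p, hp₀, hp⟩ := Nat.exists_infinite_primes p₀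
  haveI : Fact p.Prime := ⟨hp⟩
  obtain ⟨S, hS, hdes⟩ := tangencyFlags_linePencil p
  refine ⟨p, ‹_›, hp₀, S, ?_, hdes⟩
  rw [Real.rpow_one, one_mul, hS]

end LinePencil

section Certified

/-- Transfer lemma for certified instances: a list `L` of quadruples `(a, b, c, d)` over `ZMod q`
encodes the flags `((a, b), (c, d))`; if the quadruple list satisfies the (decidable) design
condition `a c' + b d' = 1 ↔ t = t'` and has no duplicates, the encoded flag set has `|S| = |L|`
and satisfies the design condition of `stub_tangencySets`. [elementary] -/
theorem tangencyFlags_of_list (q : ℕ) [NeZero q]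
    (L : List (ZMod q × ZMod q × ZMod q × ZMod q)) (hnd : L.Nodup)
    (hdes : ∀ t ∈ L, ∀ t' ∈ L, (t.1 * t'.2.2.1 + t.2.1 * t'.2.2.2 = 1 ↔ t = t')) :
    ∃ S : Finset ((Fin 2 → ZMod q) × (Fin 2 → ZMod q)), S.card = L.length ∧
      ∀ f ∈ S, ∀ f' ∈ S, (dotProduct f.1 f'.2 = 1 ↔ f = f') := by
  classical
  let e : ZMod q × ZMod q × ZMod q × ZMod q → (Fin 2 → ZMod q) × (Fin 2 → ZMod q) :=
    fun t => (![t.1, t.2.1], ![t.2.2.1, t.2.2.2])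
  have he : Function.Injective e := by
    intro t t' h
    have h1 := congrArg (fun q : (Fin 2 → ZMod q) × (Fin 2 → ZMod q) => q.1 0) h
    have h2 := congrArg (fun q : (Fin 2 → ZMod q) × (Fin 2 → ZMod q) => q.1 1) h
    have h3 := congrArg (fun q : (Fin 2 → ZMod q) × (Fin 2 → ZMod q) => q.2 0) h
    have h4 := congrArg (fun q : (Fin 2 → ZMod q) × (Fin 2 → ZMod q) => q.2 1) h
    simp only [e, Matrix.cons_val_zero, Matrix.cons_val_one] at h1 h2 h3 h4
    exact Prod.ext h1 (Prod.ext h2 (Prod.ext h3 h4))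
  refine ⟨L.toFinset.image e, ?_, ?_⟩
  · rw [Finset.card_image_of_injective _ he, List.toFinset_card_of_nodup hnd]
  · intro f hf f' hf'
    simp only [Finset.mem_image, List.mem_toFinset] at hf hf'
    obtain ⟨t, ht, rfl⟩ := hf
    obtain ⟨t', ht', rfl⟩ := hf'
    rw [he.eq_iff, ← hdes t ht t' ht']
    simp [e]

/-- **Certified instance `p = 3`: 4 flags** (`0.77 · 3^{3/2}`; ISW ceiling `3√3 + 1 < 7`). -/
theorem tangencyFlags_three :
    ∃ S : Finset ((Fin 2 → ZMod 3) × (Fin 2 → ZMod 3)), S.card = 4 ∧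
      ∀ f ∈ S, ∀ f' ∈ S, (dotProduct f.1 f'.2 = 1 ↔ f = f') :=
  tangencyFlags_of_list 3
    [(1, 0, 1, 2), (1, 1, 0, 1), (1, 2, 0, 2), (2, 0, 2, 0)] (by decide +kernel) (by decide +kernel)

/-- **Certified instance `p = 5`: 10 flags** (`0.89 · 5^{3/2}`; ISW ceiling `5√5 + 1 < 13`). -/
theorem tangencyFlags_five :
    ∃ S : Finset ((Fin 2 → ZMod 5) × (Fin 2 → ZMod 5)), S.card = 10 ∧
      ∀ f ∈ S, ∀ f' ∈ S, (dotProduct f.1 f'.2 = 1 ↔ f = f') :=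
  tangencyFlags_of_list 5
    [(0, 3, 2, 2), (0, 4, 1, 4), (1, 1, 3, 3), (1, 3, 3, 1), (1, 4, 4, 3), (2, 2, 0, 3),
     (2, 3, 4, 1), (2, 4, 1, 1), (3, 1, 2, 0), (4, 1, 4, 0)] (by decide +kernel) (by decide +kernel)

/-- **Certified instance `p = 7`: 17 flags** (`0.92 · 7^{3/2}`; ISW ceiling `7√7 + 1 < 20`). -/
theorem tangencyFlags_seven :
    ∃ S : Finset ((Fin 2 → ZMod 7) × (Fin 2 → ZMod 7)), S.card = 17 ∧
      ∀ f ∈ S, ∀ f' ∈ S, (dotProduct f.1 f'.2 = 1 ↔ f = f') :=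
  tangencyFlags_of_list 7
    [(0, 2, 0, 4), (0, 4, 0, 2), (1, 1, 2, 6), (1, 5, 6, 6), (1, 6, 6, 5), (2, 1, 4, 0),
     (3, 0, 5, 1), (3, 1, 1, 5), (3, 6, 2, 5), (4, 3, 2, 0), (5, 0, 3, 3), (5, 3, 1, 1),
     (5, 5, 4, 6), (5, 6, 6, 1), (6, 1, 2, 3), (6, 3, 1, 3), (6, 5, 4, 1)] (by decide +kernel) (by decide +kernel)

end Certified

end TangencyCertified

end Summit.MatrixMultiplication.MatrixMultiplication.Theorems.LevelOneGL2Designs.FlagLine
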